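import Mathlib.Analysis.SpecialFunctions.Log.Basic
import Literature.Probability.LatticeModels.RCGluing
import Literature.Probability.LatticeModels.DiscreteIsoperimetry
import HarnessLib

/-!
# Random-cluster contours, VII: the Peierls estimate

Topic `Literature/Probability/LatticeModels`. The energy–entropy input of the Pirogov–Sinai analysis of the
large-`q` random-cluster model (Laanait–Messager–Miracle-Solé–Ruiz–Shlosman 1991; Grimmett 2006, §7.5,
Thm. (7.42) with the rate `τ = (1/8d) log q - 5` of (7.44) and the `τ`-functional property (7.55)) for the
thick site-contours of `RCContours`–`RCGluing` (Friedli–Velenik 2017, Ch. 7, where the corresponding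
"Peierls condition" `ρ(γ) ≤ e^{-τ|γ̄|}` is the standing hypothesis (7.52) of §7.4.2): for every well-formed
contour `γ` with support `γ̄`, intrinsic energy `e(γ)` (open half-edges at the sites of `γ̄`) and cluster
exponent `cwt(γ)` (`RCWeights`),

* `peierls_counting` : `|γ̄| + 9^d (d+1) (e(γ) + 2d·cwt(γ)) ≤ 9^d (d+1) · 2d |γ̄|`, i.e.
  `e(γ)/2d + cwt(γ) ≤ (1 - 1/(2d(d+1)9^d)) |γ̄|` — in units of `log q` at the balance point `t^{2d} = q`
  of the two ground weights (`t^{2d}` per site for `ord`, `q` per site for `dis`, `t² = p/(1-p)`) the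
  weight `t^{e(γ)} q^{cwt(γ)}` of a contour falls short of the ground weight of its support by a fixed
  fraction of `|γ̄|`;
* `peierls_weight` : for `t > 0`, `q ≥ 1` in the window `|2d log t - log q| ≤ 1`,
  `t^{e(γ)} q^{cwt(γ)} ≤ e^{-τ(q)|γ̄|} min(t^{2d}, q)^{|γ̄|}` with `τ(q) = rcPeierlsRate d q =
  log q/(2d(d+1)9^d) - 2` (`peierls_weight_ord`, `peierls_weight_dis`: relative to either ground weight),
  which is the hypothesis `hρτ` of `ContourModel.K_le_exp_of_excess_eq_zero` (`PSStabilityInduction`) for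
  the contour weights normalised by the ground weight of their type.

The proof is a charging argument on the classes `C` of the glued graph (`Rsharp` on `Ugl`): with `clC(C)`
the closed half-edges at the support sites of `C`, `2d|γ̄| - e(γ) = Σ_C clC(C)` and `cwt = #classes -
[type = ord]`, so the deficit `2d|γ̄| - e - 2d·cwt` is `Σ_C (clC(C) - 2d) + 2d[ord]`. No open edge leaves a
class at a support site (`not_isOpen_of_not_mem_cls`), so the boundary pairs of the class filled with the
`ord` interior components glued to it are closed half-edges of the class (`boundaryPairs_fill`); a class
with an open edge at a support site has two sites, hence (`le_card_boundaryPairs_of_one_lt`, an elementary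
`2d + 2` edge-isoperimetric bound in `ℤ^d`, `d ≥ 2`) `clC ≥ 2d + 2`, which gives `(d+1)(clC - 2d) ≥ tC`, the
closed half-edges at support sites with an open edge (`per_class`); the exterior class of an `ord` contour is
paid for by the `+2d`. Summing, `(d+1)·(2d|γ̄| - e - 2d·cwt) ≥ Σ_C tC(C) ≥ #mixed` (sites with an open and a
closed edge), and `|γ̄| ≤ 9^d #mixed` because the support is the thickening of its bad sites and every bad
site has a mixed site in its ball (`exists_mixed_of_iBad`, a discrete intermediate-value walk inside the
ball, `exists_adj_flip`).

Everything is proved; no named facts.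

## References

* G. Grimmett, *The Random-Cluster Model*, Springer 2006, §7.5: Thm. (7.33), Thm. (7.42) with (7.44),
  proof of Thm. (7.42) eq. (7.55) (`Φ_w(γ) ≤ e^{-τ‖γ‖}`, `Φ_f(γ) ≤ e^{-τ‖γ‖}`). [Grimmett2006]
* L. Laanait, A. Messager, S. Miracle-Solé, J. Ruiz, S. Shlosman, Comm. Math. Phys. 140 (1991) 81–91
  (Grimmett's [224]). [LaanaitMessagerMiracleSoleRuizShlosman1991]
* S. Friedli, Y. Velenik, *Statistical Mechanics of Lattice Systems*, CUP 2017, §7.2.1 (correct/incorrect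
  sites), §7.4.2 eq. (7.52) (τ-stable weights). [FriedliVelenik2017]
-/

noncomputable section

open Finset Relation

namespace Literature.Probability.LatticeModels

variable {d : ℕ}

/-! ### 1. Boundary pairs: at least `2d + 2` for two or more sites -/

section Isoperimetry

/-- The line of `x` in direction `i`, encoded by zeroing the `i`-th coordinate. [folklore] -/
def lineRep (i : Fin d) (x : Site d) : Site d := Function.update x i 0

/-- Moving along direction `i` does not change the line in direction `i`. [folklore] -/
theorem lineRep_add_unitStep (i : Fin d) (x : Site d) (b : Bool) : lineRep i (x + unitStep i b) = lineRep i x := by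
  funext j
  by_cases hj : j = i
  · subst hj; simp [lineRep]
  · simp [lineRep, Function.update_of_ne hj, unitStep, Pi.single_eq_of_ne hj]

/-- **Every line meeting `X` carries a boundary pair of each sign in its direction** (its extreme
points): the number of lines of `X` in direction `i` is at most the number of boundary pairs with
direction `i` and sign `b`. [folklore] -/
theorem card_image_lineRep_le (X : Finset (Site d)) (i : Fin d) (b : Bool) :
    #(X.image (lineRep i)) ≤ #((boundaryPairs X).filter fun t => t.2 = (i, b)) := by
  have key : ∀ ℓ ∈ X.image (lineRep i), ∃ t ∈ (boundaryPairs X).filter (fun t => t.2 = (i, b)), lineRep i t.1 = ℓ := by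
    intro ℓ hℓ
    obtain ⟨x₀, hx₀, rfl⟩ := mem_image.1 hℓ
    set F := X.filter fun x => lineRep i x = lineRep i x₀ with hF
    have hFne : F.Nonempty := ⟨x₀, mem_filter.2 ⟨hx₀, rfl⟩⟩
    obtain ⟨x, hxF, hmax⟩ := exists_max_image F (fun x => if b then x i else -x i) hFne
    obtain ⟨hxX, hxℓ⟩ := mem_filter.1 hxF
    refine ⟨(x, i, b), mem_filter.2 ⟨mem_boundaryPairs.2 ⟨hxX, fun hmem => ?_⟩, rfl⟩, hxℓ⟩
    have hF' : x + unitStep i b ∈ F := mem_filter.2 ⟨hmem, by rw [lineRep_add_unitStep, hxℓ]⟩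
    have := hmax _ hF'
    cases b <;> simp [unitStep] at this
  calc #(X.image (lineRep i))
      ≤ #(((boundaryPairs X).filter fun t => t.2 = (i, b)).image fun t => lineRep i t.1) := by
        refine card_le_card fun ℓ hℓ => ?_
        obtain ⟨t, ht, htℓ⟩ := key ℓ hℓ
        exact mem_image.2 ⟨t, ht, htℓ⟩
    _ ≤ _ := card_image_le

/-- Boundary pairs counted by direction and sign. [folklore] -/
theorem card_boundaryPairs_eq_sum (X : Finset (Site d)) :
    #(boundaryPairs X) = ∑ p : Fin d × Bool, #((boundaryPairs X).filter fun t => t.2 = p) :=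
  card_eq_sum_card_fiberwise fun _ _ => mem_univ _

/-- `#(boundaryPairs X) ≥ 2 Σᵢ #(lines of X in direction i)`. [folklore] -/
theorem two_mul_sum_card_image_lineRep_le (X : Finset (Site d)) :
    2 * ∑ i : Fin d, #(X.image (lineRep i)) ≤ #(boundaryPairs X) := by
  rw [card_boundaryPairs_eq_sum, Fintype.sum_prod_type, mul_sum]
  refine sum_le_sum fun i _ => ?_
  rw [Fintype.sum_bool, two_mul]
  exact Nat.add_le_add (card_image_lineRep_le X i true) (card_image_lineRep_le X i false)

/-- **A finite set of at least two sites of `ℤ^d`, `d ≥ 2`, has at least `2d + 2` boundary pairs**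
(two per direction from the extreme points, and two more in a direction transverse to a coordinate
where two of its points differ, where it meets two lines). [folklore] -/
theorem le_card_boundaryPairs_of_one_lt (hd : 2 ≤ d) {X : Finset (Site d)} (hX : 1 < #X) :
    2 * d + 2 ≤ #(boundaryPairs X) := by
  obtain ⟨x, hx, y, hy, hxy⟩ := one_lt_card.1 hX
  obtain ⟨j, hj⟩ : ∃ j, x j ≠ y j := Function.ne_iff.1 hxy
  obtain ⟨i₀, hi₀⟩ : ∃ i₀ : Fin d, i₀ ≠ j :=
    ⟨⟨if (j : ℕ) = 0 then 1 else 0, by split_ifs <;> omega⟩, fun h => by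
      have := congrArg Fin.val h; dsimp at this; split_ifs at this <;> omega⟩
  have h2 : 2 ≤ #(X.image (lineRep i₀)) := by
    refine one_lt_card.2 ⟨lineRep i₀ x, mem_image_of_mem _ hx, lineRep i₀ y, mem_image_of_mem _ hy, fun h => hj ?_⟩
    have := congrFun h j
    rwa [lineRep, lineRep, Function.update_of_ne (Ne.symm hi₀), Function.update_of_ne (Ne.symm hi₀)] at this
  have h1 : ∀ i, 1 ≤ #(X.image (lineRep i)) := fun i => card_pos.2 ⟨_, mem_image_of_mem _ hx⟩
  have hsum : d + 1 ≤ ∑ i : Fin d, #(X.image (lineRep i)) := by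
    rw [← add_sum_erase _ _ (mem_univ i₀)]
    have : d - 1 ≤ ∑ i ∈ univ.erase i₀, #(X.image (lineRep i)) :=
      calc d - 1 = ∑ i ∈ (univ : Finset (Fin d)).erase i₀, 1 := by simp [card_erase_of_mem]
        _ ≤ _ := sum_le_sum fun i _ => h1 i
    omega
  have := two_mul_sum_card_image_lineRep_le X
  omega

/-! ### Coordinate interpolation -/

/-- `w` lies coordinatewise between `a` and `s`. [folklore] -/
def Between (a s w : Site d) : Prop := ∀ i, min (a i) (s i) ≤ w i ∧ w i ≤ max (a i) (s i)

/-- `a` is between `a` and `s`. [folklore] -/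
theorem between_left (a s : Site d) : Between a s a := fun _ => ⟨min_le_left _ _, le_max_left _ _⟩

/-- Points between two points of a `★`-ball lie in the ball. [folklore] -/
theorem mem_starBall_of_between {b a s w : Site d} (ha : a ∈ starBall b) (hs : s ∈ starBall b) (hw : Between a s w) :
    w ∈ starBall b := by
  rw [mem_starBall, supDist_le_iff] at ha hs ⊢
  intro i
  have h1 := ha i; have h2 := hs i; obtain ⟨h3, h4⟩ := hw i
  omega

/-- Nearest-neighbour steps in one coordinate. [folklore] -/
theorem zdGraph_adj_update_succ (x : Site d) (k : Fin d) (w : ℤ) :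
    (zdGraph d).Adj (Function.update x k w) (Function.update x k (w + 1)) := by
  rw [zdGraph_adj_iff]
  refine ⟨k, Or.inl (funext fun j => ?_)⟩
  by_cases hj : j = k
  · subst hj; simp
  · simp [Function.update_of_ne hj, Pi.single_eq_of_ne hj]

/-- **Discrete intermediate value lemma**: if `P a` and `¬ P s`, some lattice edge between `a` and
`s` (coordinatewise) joins a `P`-site to a non-`P`-site. [folklore] -/
theorem exists_adj_flip {P : Site d → Prop} {a s : Site d} (ha : P a) (hs : ¬ P s) :
    ∃ w w' : Site d, P w ∧ ¬ P w' ∧ (zdGraph d).Adj w w' ∧ Between a s w ∧ Between a s w' := by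
  classical
  -- induction on the `ℓ¹` distance from `w` to `s`
  suffices key : ∀ n : ℕ, ∀ w : Site d, Between a s w → P w → ∑ i, (w i - s i).natAbs ≤ n →
      ∃ w w' : Site d, P w ∧ ¬ P w' ∧ (zdGraph d).Adj w w' ∧ Between a s w ∧ Between a s w' from
    key _ a (between_left a s) ha le_rfl
  intro n
  induction n with
  | zero =>
    intro w hw hPw hn
    have hws : w = s := funext fun i => by
      have := (sum_eq_zero_iff.1 (Nat.le_zero.1 hn)) i (mem_univ i)
      omega
    exact absurd hPw (hws ▸ hs)
  | succ n ih =>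
    intro w hw hPw hn
    by_cases hws : w = s
    · exact absurd hPw (hws ▸ hs)
    obtain ⟨i, hi⟩ : ∃ i, w i ≠ s i := Function.ne_iff.1 hws
    -- one unit step towards `s` in direction `i`
    set v : ℤ := if w i < s i then w i + 1 else w i - 1 with hv
    set w' : Site d := Function.update w i v with hw'
    have hw'i : w' i = v := by simp [hw']
    have hw'j : ∀ j, j ≠ i → w' j = w j := fun j hj => by simp [hw', Function.update_of_ne hj]
    have hbw' : Between a s w' := by
      intro j
      by_cases hj : j = i
      · subst hj
        obtain ⟨h3, h4⟩ := hw j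
        rw [hw'i, hv]
        split_ifs with hlt
        · constructor <;> omega
        · constructor <;> omega
      · rw [hw'j j hj]; exact hw j
    have hadj : (zdGraph d).Adj w w' := by
      by_cases hlt : w i < s i
      · have h := zdGraph_adj_update_succ w i (w i)
        rw [Function.update_eq_self] at h
        have : w' = Function.update w i (w i + 1) := by rw [hw', hv, if_pos hlt]
        rwa [this]
      · have h := zdGraph_adj_update_succ w i (w i - 1)
        rw [sub_add_cancel, Function.update_eq_self] at h
        have : w' = Function.update w i (w i - 1) := by rw [hw', hv, if_neg hlt]
        rw [this]; exact h.symm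
    by_cases hPw' : P w'
    · -- recurse: the distance dropped
      refine ih w' hbw' hPw' (Nat.lt_succ_iff.1 (lt_of_lt_of_le ?_ hn))
      refine sum_lt_sum (fun j _ => ?_) ⟨i, mem_univ _, ?_⟩
      · by_cases hj : j = i
        · subst hj; rw [hw'i, hv]; split_ifs <;> omega
        · rw [hw'j j hj]
      · rw [hw'i, hv]; split_ifs <;> omega
    · exact ⟨w, w', hPw, hPw', hadj, hw, hbw'⟩

end Isoperimetry

/-! ### 2. Contour geometry for the Peierls estimate -/

namespace RCC

open ContourSetup ClassCount

section Peierls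

variable (hd : 2 ≤ d) (γ : (rcSetup d).Γ)

/-- The support lies in the glued set. [folklore] -/
theorem supp_subset_Ugl : γ.1.supp ⊆ γ.1.Ugl := fun _ hx =>
  mem_union.2 (Or.inl (mem_union.2 (Or.inl hx)))

/-- The exterior block lies in the glued set. [folklore] -/
theorem opart_subset_Ugl : γ.1.Opart ⊆ γ.1.Ugl := fun _ hx =>
  mem_union.2 (Or.inl (mem_union.2 (Or.inr hx)))

/-- The interior boundary of an `ord` interior component lies in the glued set. [folklore] -/
theorem inBoundary_subset_Ugl {A : Finset (Site d)} (hA : A ∈ γ.1.ordInts) : inBoundary A ⊆ γ.1.Ugl := fun _ hx =>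
  mem_union.2 (Or.inr (mem_biUnion.2 ⟨A, hA, hx⟩))

/-- Membership in `ordInts`. [folklore] -/
theorem mem_ordInts_iff {A : Finset (Site d)} :
    A ∈ γ.1.ordInts ↔ (∃ u ∈ starInt γ.1.supp, starIntComp γ.1.supp u = A) ∧ γ.1.lab A = Phase.ord := by
  rw [Contour.ordInts, mem_filter, Contour.intComps, mem_image]

include hd in
/-- A site off an interior component but `★`-adjacent to it lies in the support. [folklore] -/
theorem mem_supp_of_adj_of_mem_ordInts {A : Finset (Site d)} (hA : A ∈ γ.1.ordInts) {a b : Site d} (ha : a ∈ A) (hb : b ∉ A)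
    (hab : (zdStar d).Adj a b) : b ∈ γ.1.supp := by
  obtain ⟨⟨u, hu, rfl⟩, -⟩ := (mem_ordInts_iff γ).1 hA
  by_contra hbS
  exact hb (mem_starIntComp_of_starRel hd hu ha ⟨hab, fun h => ((mem_starInt hd).1 (starIntComp_subset _ _ ha)).1 (mem_coe.1 h),
    fun h => hbS (mem_coe.1 h)⟩)

include hd in
/-- **An intrinsically open lattice edge at a support site ends in the glued set** (in the support, in
the exterior block, or on the interior boundary of an `ord`-labelled interior component).
[cite: FriedliVelenik2017, §7.2.6, Lemma 7.19] -/
theorem mem_Ugl_of_isOpen {x y : Site d} (hx : x ∈ γ.1.supp) (hxy : (zdGraph d).Adj x y) (ho : γ.1.IsOpen s(x, y)) :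
    y ∈ γ.1.Ugl := by
  classical
  obtain ⟨-, -, h3, h4, h5, h6⟩ := WF.consistency hd γ.2
  by_cases hyS : y ∈ γ.1.supp
  · exact supp_subset_Ugl γ hyS
  have hnn : s(x, y) ∉ nnEdges γ.1.supp := fun h => hyS (mk_mem_nnEdges.1 h).2.2
  rcases ho with ho | ⟨-, u, hu, huS, y', hy'B, huy'⟩
  · exact absurd (h5 ho) hnn
  have huy : u = y := by
    rcases Sym2.mem_iff.1 hu with rfl | rfl
    · exact absurd hx huS
    · rfl
  subst huy
  have hxu : (zdStar d).Adj x u := zdGraph_le_zdStar hxy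
  have hy'b : y' ∈ exBoundary γ.1.supp := h6 hy'B
  rcases mem_starExt_or_mem_starInt hd huS with hue | hui
  · -- exterior component: the type is `ord` and `u` lies in the exterior block
    have hy'e : y' ∈ starExt γ.1.supp := mem_starExt_of_reflTransGen hue huy'
    have htype : γ.1.type = Phase.ord := (h3 y' hy'b hy'e).1 hy'B
    refine opart_subset_Ugl γ ?_
    rw [Contour.Opart, if_pos htype, mem_exBoundary]
    exact ⟨fun h => ((mem_starHullFinset hd).1 h) hue, x,
      (mem_starHullFinset hd).2 (subset_starHull _ (mem_coe.2 hx)), hxu⟩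
  · -- interior component `A` of `u`: `ord`-labelled, and `u ∈ ∂^in A`
    set A := starIntComp γ.1.supp u with hAdef
    have hy'A : y' ∈ A := (mem_starIntComp hd hui).2 huy'
    have hy'in : y' ∈ inBoundary A := by
      obtain ⟨-, s, hs, hsy'⟩ := mem_exBoundary.1 hy'b
      exact mem_inBoundary.2 ⟨hy'A, s, fun hsA => ((mem_starInt hd).1 (starIntComp_subset _ _ hsA)).1 hs, hsy'.symm⟩
    have hlab : γ.1.lab A = Phase.ord := (h4 u hui y' hy'in).1 hy'B
    have huin : u ∈ inBoundary A := mem_inBoundary.2 ⟨mem_starIntComp_self hd hui, x,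
      fun hxA => ((mem_starInt hd).1 (starIntComp_subset _ _ hxA)).1 hx, hxu.symm⟩
    exact inBoundary_subset_Ugl γ ((mem_ordInts_iff γ).2 ⟨⟨u, hui, rfl⟩, hlab⟩) huin

include hd in
/-- **No intrinsically open edge leaves a class of the glued graph at a support site.** [cite: Grimmett2006, §7.5] -/
theorem not_isOpen_of_not_mem_cls {x₀ x y : Site d} (hx : x ∈ γ.1.supp) (hxC : x ∈ cls γ.1.Rsharp γ.1.Ugl x₀)
    (hxy : (zdGraph d).Adj x y) (hyC : y ∉ cls γ.1.Rsharp γ.1.Ugl x₀) : ¬ γ.1.IsOpen s(x, y) := fun ho =>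
  hyC (mem_cls.2 ⟨mem_Ugl_of_isOpen hd γ hx hxy ho,
    (mem_cls.1 hxC).2.tail ⟨Or.inl ⟨hxy, ho⟩, supp_subset_Ugl γ hx, mem_Ugl_of_isOpen hd γ hx hxy ho⟩⟩)

include hd in
/-- Interior-boundary sites of `ord`-labelled interior components are intrinsically `ord`-good.
[cite: FriedliVelenik2017, §7.2.6, Lemma 7.19] -/
theorem iOrdGood_of_mem_inBoundary {A : Finset (Site d)} (hA : A ∈ γ.1.ordInts) {y : Site d} (hy : y ∈ inBoundary A) :
    γ.1.IOrdGood y := by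
  obtain ⟨-, h2, -, h4, -, h6⟩ := WF.consistency hd γ.2
  obtain ⟨⟨u, hu, rfl⟩, hlab⟩ := (mem_ordInts_iff γ).1 hA
  have hyB : y ∈ γ.1.ordB := (h4 u hu y hy).2 hlab
  exact (h2 y (h6 hyB)).2.1.2 hyB

include hd in
/-- Sites of the exterior block are intrinsically `ord`-good. [cite: FriedliVelenik2017, §7.2.6, Lemma 7.19] -/
theorem iOrdGood_of_mem_Opart {y : Site d} (hy : y ∈ γ.1.Opart) : γ.1.IOrdGood y := by
  obtain ⟨-, h2, h3, -, -, -⟩ := WF.consistency hd γ.2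
  rw [Contour.Opart] at hy
  split_ifs at hy with ht
  · obtain ⟨hyb, hye⟩ := mem_exBoundary_of_mem_exBoundary_hull hd hy
    exact (h2 y hyb).2.1.2 ((h3 y hyb hye).2 ht)
  · exact absurd hy (notMem_empty y)

/-- An edge with both endpoints in the ball of `z` is a ball edge of `z`. [folklore] -/
theorem mk_mem_ballEdges {z w w' : Site d} (hw : w ∈ starBall z) (hw' : w' ∈ starBall z) (h : (zdGraph d).Adj w w') :
    s(w, w') ∈ ballEdges z :=
  mem_ballEdges_iff.2 ⟨(SimpleGraph.mem_edgeSet _).2 h, by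
    rw [coBall_mk, mem_inter, mem_starBall_comm, mem_starBall_comm (x := w')]; exact ⟨hw, hw'⟩⟩

/-- An intrinsically open edge at `x` makes `oDeg x` positive. [folklore] -/
theorem oDeg_pos_of_isOpen {x y : Site d} (hxy : (zdGraph d).Adj x y) (ho : γ.1.IsOpen s(x, y)) : 0 < γ.1.oDeg x := by
  classical
  rw [Contour.oDeg]
  exact card_pos.2 ⟨y, mem_filter.2 ⟨mem_nbrs.2 hxy, ho⟩⟩

/-- With `oDeg x = 2d` every lattice edge at `x` is intrinsically open. [folklore] -/
theorem isOpen_of_oDeg_eq {x y : Site d} (h : γ.1.oDeg x = 2 * d) (hxy : (zdGraph d).Adj x y) : γ.1.IsOpen s(x, y) := by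
  classical
  rw [Contour.oDeg, ← card_nbrs x] at h
  have := (eq_of_subset_of_card_le (filter_subset _ _) h.ge) ▸ mem_nbrs.2 hxy
  exact (mem_filter.1 this).2

/-- The intrinsic open degree is at most `2d`. [folklore] -/
theorem Contour.oDeg_le_two_mul (x : Site d) : γ.1.oDeg x ≤ 2 * d := by
  classical
  rw [Contour.oDeg, ← card_nbrs x]
  exact card_le_card (filter_subset _ _)

/-- A closed lattice edge at `x` makes `oDeg x < 2d`. [folklore] -/
theorem oDeg_lt_of_not_isOpen {x y : Site d} (hxy : (zdGraph d).Adj x y) (ho : ¬ γ.1.IsOpen s(x, y)) : γ.1.oDeg x < 2 * d := by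
  classical
  rw [Contour.oDeg, ← card_nbrs x]
  exact card_lt_card ⟨filter_subset _ _, fun h => ho (mem_filter.1 (h (mem_nbrs.2 hxy))).2⟩

include hd in
/-- **A block class contains a support site with an open edge**: from a site `z` of the interior boundary
of an `ord`-labelled interior component `A`, some `w ∈ ∂^in A` in the ball of `z` is joined by an
intrinsically open lattice edge to a support site `w'` in the ball of `z`. [cite: Grimmett2006, §7.5] -/
theorem exists_open_exit_of_mem_inBoundary {A : Finset (Site d)} (hA : A ∈ γ.1.ordInts) {z : Site d} (hz : z ∈ inBoundary A) :
    ∃ w w' : Site d, w ∈ inBoundary A ∧ w' ∈ γ.1.supp ∧ (zdGraph d).Adj w w' ∧ γ.1.IsOpen s(w, w') ∧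
      w ∈ starBall z ∧ w' ∈ starBall z := by
  obtain ⟨hzA, s₀, hs₀A, hzs₀⟩ := mem_inBoundary.1 hz
  obtain ⟨w, w', hwA, hw'A, hadj, hbw, hbw'⟩ := exists_adj_flip (P := fun w => w ∈ A) hzA hs₀A
  have hs₀ : s₀ ∈ starBall z := (adj_iff_mem_starBall.1 hzs₀).1
  have hwz : w ∈ starBall z := mem_starBall_of_between (mem_starBall_self z) hs₀ hbw
  have hw'z : w' ∈ starBall z := mem_starBall_of_between (mem_starBall_self z) hs₀ hbw'
  have hw'S : w' ∈ γ.1.supp := mem_supp_of_adj_of_mem_ordInts hd γ hA hwA hw'A (zdGraph_le_zdStar hadj)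
  have hwin : w ∈ inBoundary A := mem_inBoundary.2 ⟨hwA, w', hw'A, zdGraph_le_zdStar hadj⟩
  exact ⟨w, w', hwin, hw'S, hadj, iOrdGood_of_mem_inBoundary hd γ hA hz _ (mk_mem_ballEdges hwz hw'z hadj), hwz, hw'z⟩

include hd in
/-- **Every class of the glued graph avoiding the exterior block contains a support site; if it is
generated by a block site, one with an open edge.** [cite: Grimmett2006, §7.5] -/
theorem exists_mem_cls_supp {x₀ : Site d} (hx₀ : x₀ ∈ γ.1.Ugl) (hO : x₀ ∉ γ.1.Opart) :
    ∃ x ∈ cls γ.1.Rsharp γ.1.Ugl x₀, x ∈ γ.1.supp ∧ (x₀ ∉ γ.1.supp → 0 < γ.1.oDeg x) := by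
  by_cases hx₀S : x₀ ∈ γ.1.supp
  · exact ⟨x₀, mem_cls_self hx₀, hx₀S, fun h => absurd hx₀S h⟩
  rw [Contour.Ugl, mem_union, mem_union] at hx₀
  rcases hx₀ with (h | h) | h
  · exact absurd h hx₀S
  · exact absurd h hO
  obtain ⟨A, hA, hzA⟩ := mem_biUnion.1 h
  obtain ⟨w, w', hw, hw'S, hadj, ho, -, -⟩ := exists_open_exit_of_mem_inBoundary hd γ hA hzA
  have hU := inBoundary_subset_Ugl γ hA
  refine ⟨w', mem_cls.2 ⟨supp_subset_Ugl γ hw'S, ?_⟩, hw'S, fun _ => ?_⟩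
  · exact (ReflTransGen.single ⟨Or.inr (Or.inr ⟨A, hA, hzA, hw⟩), hU hzA, hU hw⟩).tail
      ⟨Or.inl ⟨hadj, ho⟩, hU hw, supp_subset_Ugl γ hw'S⟩
  · rw [Sym2.eq_swap] at ho
    exact oDeg_pos_of_isOpen γ hadj.symm ho

/-! ### 3. Classes of the glued graph, closed half-edges and the counting -/

/-- The number of intrinsically closed lattice edges at `x`. [cite: Grimmett2006, §7.5] -/
def Contour.cDeg (γ : Contour d) (x : Site d) : ℕ := by classical exact #((nbrs x).filter fun y => ¬ γ.IsOpen s(x, y))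

/-- The classes of the glued graph of a contour. [cite: Grimmett2006, §7.5] -/
def Contour.classes (γ : Contour d) : Finset (Finset (Site d)) := γ.Ugl.image (cls γ.Rsharp γ.Ugl)

/-- **The filled class**: a class of the glued graph together with the `ord`-labelled interior components
whose interior boundary it meets. [folklore] -/
def Contour.fill (γ : Contour d) (C : Finset (Site d)) : Finset (Site d) :=
  C ∪ (γ.ordInts.filter fun A => (inBoundary A ∩ C).Nonempty).biUnion id

/-- The closed half-edges of a class at its support sites. [cite: Grimmett2006, §7.5] -/
def Contour.clC (γ : Contour d) (C : Finset (Site d)) : ℕ := ∑ x ∈ C ∩ γ.supp, γ.cDeg x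

/-- The closed half-edges of a class at its support sites carrying an open edge. [folklore] -/
def Contour.tC (γ : Contour d) (C : Finset (Site d)) : ℕ := ∑ x ∈ (C ∩ γ.supp).filter (fun x => 0 < γ.oDeg x), γ.cDeg x

/-- `oDeg x + cDeg x = 2d`. [folklore] -/
theorem oDeg_add_cDeg (x : Site d) : γ.1.oDeg x + γ.1.cDeg x = 2 * d := by
  classical
  rw [Contour.oDeg, Contour.cDeg, card_filter_add_card_filter_not, card_nbrs]

/-- `#classes = ccl`. [folklore] -/
theorem card_classes : #γ.1.classes = γ.1.ccl := rfl

/-- Membership in `fill`. [folklore] -/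
theorem mem_fill {C : Finset (Site d)} {x : Site d} :
    x ∈ γ.1.fill C ↔ x ∈ C ∨ ∃ A ∈ γ.1.ordInts, (inBoundary A ∩ C).Nonempty ∧ x ∈ A := by
  simp only [Contour.fill, mem_union, mem_biUnion, mem_filter, id_eq, and_assoc]

/-- A class meeting an `ord` interior boundary contains all of it (the block is wired). [folklore] -/
theorem inBoundary_subset_cls {A : Finset (Site d)} (hA : A ∈ γ.1.ordInts) {x₀ : Site d}
    (h : (inBoundary A ∩ cls γ.1.Rsharp γ.1.Ugl x₀).Nonempty) : inBoundary A ⊆ cls γ.1.Rsharp γ.1.Ugl x₀ := by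
  obtain ⟨b, hb⟩ := h
  obtain ⟨hbA, hbC⟩ := mem_inter.1 hb
  intro a ha
  exact mem_cls.2 ⟨inBoundary_subset_Ugl γ hA ha, (mem_cls.1 hbC).2.tail
    ⟨Or.inr (Or.inr ⟨A, hA, hbA, ha⟩), inBoundary_subset_Ugl γ hA hbA, inBoundary_subset_Ugl γ hA ha⟩⟩

/-- A class meeting the exterior block contains all of it. [folklore] -/
theorem opart_subset_cls {x₀ : Site d} (h : (γ.1.Opart ∩ cls γ.1.Rsharp γ.1.Ugl x₀).Nonempty) :
    γ.1.Opart ⊆ cls γ.1.Rsharp γ.1.Ugl x₀ := by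
  obtain ⟨b, hb⟩ := h
  obtain ⟨hbO, hbC⟩ := mem_inter.1 hb
  intro a ha
  exact mem_cls.2 ⟨opart_subset_Ugl γ ha, (mem_cls.1 hbC).2.tail ⟨Or.inr (Or.inl ⟨hbO, ha⟩), opart_subset_Ugl γ hbO, opart_subset_Ugl γ ha⟩⟩

include hd in
/-- **Boundary pairs of a filled non-exterior class are closed half-edges at its support sites.**
[cite: Grimmett2006, §7.5] -/
theorem boundaryPairs_fill {x₀ : Site d} (hO : Disjoint γ.1.Opart (cls γ.1.Rsharp γ.1.Ugl x₀))
    {t : Site d × Fin d × Bool} (ht : t ∈ boundaryPairs (γ.1.fill (cls γ.1.Rsharp γ.1.Ugl x₀))) :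
    t.1 ∈ cls γ.1.Rsharp γ.1.Ugl x₀ ∧ t.1 ∈ γ.1.supp ∧ ¬ γ.1.IsOpen s(t.1, t.1 + unitStep t.2.1 t.2.2) := by
  set C := cls γ.1.Rsharp γ.1.Ugl x₀ with hC
  obtain ⟨hx, hy⟩ := mem_boundaryPairs.1 ht
  have hxy : (zdGraph d).Adj t.1 (t.1 + unitStep t.2.1 t.2.2) := zdGraph_adj_add_unitStep _ _ _
  -- an open edge from a site of `C` into the glued set stays in `C`
  have hstep : ∀ {a b : Site d}, a ∈ C → γ.1.IsOpen s(a, b) → (zdGraph d).Adj a b → b ∈ γ.1.Ugl → b ∈ C :=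
    fun ha ho hab hbU => mem_cls.2 ⟨hbU, (mem_cls.1 ha).2.tail ⟨Or.inl ⟨hab, ho⟩, cls_subset _ ha, hbU⟩⟩
  -- case 1: `t.1` in a glued interior component (impossible)
  by_cases hglued : ∃ A ∈ γ.1.ordInts, (inBoundary A ∩ C).Nonempty ∧ t.1 ∈ A
  · exfalso
    obtain ⟨A, hA, hAC, hxA⟩ := hglued
    have hyA : t.1 + unitStep t.2.1 t.2.2 ∉ A := fun hyA => hy ((mem_fill γ).2 (Or.inr ⟨A, hA, hAC, hyA⟩))
    have hyS : t.1 + unitStep t.2.1 t.2.2 ∈ γ.1.supp :=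
      mem_supp_of_adj_of_mem_ordInts hd γ hA hxA hyA (zdGraph_le_zdStar hxy)
    have hxin : t.1 ∈ inBoundary A := mem_inBoundary.2 ⟨hxA, _, hyA, zdGraph_le_zdStar hxy⟩
    have hxC : t.1 ∈ C := inBoundary_subset_cls γ hA hAC hxin
    have ho : γ.1.IsOpen s(t.1, t.1 + unitStep t.2.1 t.2.2) := iOrdGood_of_mem_inBoundary hd γ hA hxin _
      (mk_mem_ballEdges (mem_starBall_self _) (adj_iff_mem_starBall.1 (zdGraph_le_zdStar hxy)).1 hxy)
    exact hy ((mem_fill γ).2 (Or.inl (hstep hxC ho hxy (supp_subset_Ugl γ hyS))))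
  -- case 2: `t.1 ∈ C`, and then it is a support site
  have hxC : t.1 ∈ C := by
    rcases (mem_fill γ).1 hx with h | ⟨A, hA, hAC, hxA⟩
    · exact h
    · exact absurd ⟨A, hA, hAC, hxA⟩ hglued
  have hxS : t.1 ∈ γ.1.supp := by
    have hxU : t.1 ∈ γ.1.Ugl := cls_subset _ hxC
    rw [Contour.Ugl, mem_union, mem_union] at hxU
    rcases hxU with (h | h) | h
    · exact h
    · exact absurd hxC (Finset.disjoint_left.1 hO h)
    · exfalso
      obtain ⟨A, hA, hxA⟩ := mem_biUnion.1 h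
      exact hglued ⟨A, hA, ⟨t.1, mem_inter.2 ⟨hxA, hxC⟩⟩, (mem_inBoundary.1 hxA).1⟩
  have hyC : t.1 + unitStep t.2.1 t.2.2 ∉ C := fun h => hy ((mem_fill γ).2 (Or.inl h))
  exact ⟨hxC, hxS, not_isOpen_of_not_mem_cls hd γ hxS hxC hxy hyC⟩

/-- `unitStep` is injective in direction and sign. [folklore] -/
theorem unitStep_inj {i i' : Fin d} {b b' : Bool} (h : unitStep i b = unitStep i' b') : i = i' ∧ b = b' := by
  have hi : i = i' := by
    by_contra hne
    have := congrFun h i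
    simp only [unitStep, Pi.single_eq_same, Pi.single_eq_of_ne hne] at this
    cases b <;> simp at this
  subst hi
  have := congrFun h i
  simp only [unitStep, Pi.single_eq_same] at this
  refine ⟨rfl, ?_⟩
  cases b <;> cases b' <;> simp_all

include hd in
/-- **The closed half-edges of a non-exterior class dominate the boundary pairs of its filling.**
[cite: Grimmett2006, §7.5] -/
theorem card_boundaryPairs_fill_le {x₀ : Site d} (hO : Disjoint γ.1.Opart (cls γ.1.Rsharp γ.1.Ugl x₀)) :
    #(boundaryPairs (γ.1.fill (cls γ.1.Rsharp γ.1.Ugl x₀))) ≤ γ.1.clC (cls γ.1.Rsharp γ.1.Ugl x₀) := by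
  classical
  have hcl : γ.1.clC (cls γ.1.Rsharp γ.1.Ugl x₀) =
      #((cls γ.1.Rsharp γ.1.Ugl x₀ ∩ γ.1.supp).sigma fun x => (nbrs x).filter fun y => ¬ γ.1.IsOpen s(x, y)) := by
    rw [Contour.clC, card_sigma]; rfl
  rw [hcl]
  refine card_le_card_of_injOn (fun t => (⟨t.1, t.1 + unitStep t.2.1 t.2.2⟩ : Σ _ : Site d, Site d)) (fun t ht => ?_) ?_
  · obtain ⟨h1, h2, h3⟩ := boundaryPairs_fill hd γ hO (mem_coe.1 ht)
    exact mem_coe.2 (mem_sigma.2 ⟨mem_inter.2 ⟨h1, h2⟩, mem_filter.2 ⟨mem_nbrs.2 (zdGraph_adj_add_unitStep _ _ _), h3⟩⟩)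
  · rintro ⟨x, i, b⟩ - ⟨x', i', b'⟩ - h
    simp only [Sigma.mk.injEq] at h
    obtain ⟨rfl, h⟩ := h
    have h' := add_left_cancel (eq_of_heq h)
    obtain ⟨rfl, rfl⟩ := unitStep_inj h'
    rfl

/-! ### Sums over classes -/

/-- **A sum over the support splits over the classes of the glued graph.** [folklore] -/
theorem sum_supp_eq_sum_classes (f : Site d → ℕ) :
    ∑ x ∈ γ.1.supp, f x = ∑ C ∈ γ.1.classes, ∑ x ∈ C ∩ γ.1.supp, f x := by
  classical
  have hmaps : ∀ x ∈ γ.1.supp, cls γ.1.Rsharp γ.1.Ugl x ∈ γ.1.classes := fun x hx =>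
    mem_image_of_mem _ (supp_subset_Ugl γ hx)
  rw [← sum_fiberwise_of_maps_to hmaps]
  refine sum_congr rfl fun C hC => sum_congr ?_ fun _ _ => rfl
  obtain ⟨z, -, rfl⟩ := mem_image.1 hC
  ext x
  rw [mem_filter, mem_inter]
  constructor
  · rintro ⟨hxS, hxz⟩
    exact ⟨hxz ▸ mem_cls_self (supp_subset_Ugl γ hxS), hxS⟩
  · rintro ⟨hxz, hxS⟩
    exact ⟨hxS, cls_eq_of_mem γ.1.rsharp_symm hxz⟩

/-- `Σ_C clC C + e(γ) = 2d |γ̄|`. [cite: Grimmett2006, §7.5] -/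
theorem sum_clC_add_energy : ∑ C ∈ γ.1.classes, γ.1.clC C + γ.1.energy = 2 * d * #γ.1.supp := by
  have h1 : ∑ C ∈ γ.1.classes, γ.1.clC C = ∑ x ∈ γ.1.supp, γ.1.cDeg x := (sum_supp_eq_sum_classes γ _).symm
  rw [h1, Contour.energy, ← sum_add_distrib, card_eq_sum_ones, mul_sum]
  exact sum_congr rfl fun x _ => by rw [add_comm, oDeg_add_cDeg, mul_one]

/-- `Σ_C tC C = Σ_{x ∈ γ̄, oDeg x > 0} cDeg x`. [folklore] -/
theorem sum_tC_eq : ∑ C ∈ γ.1.classes, γ.1.tC C = ∑ x ∈ γ.1.supp.filter (fun x => 0 < γ.1.oDeg x), γ.1.cDeg x := by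
  rw [sum_filter, sum_supp_eq_sum_classes γ]
  exact sum_congr rfl fun C _ => by rw [Contour.tC, sum_filter]

/-- `tC ≤ clC`. [folklore] -/
theorem tC_le_clC (C : Finset (Site d)) : γ.1.tC C ≤ γ.1.clC C :=
  sum_le_sum_of_subset_of_nonneg (filter_subset _ _) fun _ _ _ => Nat.zero_le _

/-- At most one class meets the exterior block, and none if the type is `dis`. [folklore] -/
theorem card_filter_ext_le : #(γ.1.classes.filter fun C => ¬ Disjoint γ.1.Opart C) ≤ if γ.1.type = Phase.ord then 1 else 0 := by
  classical
  split_ifs with ht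
  · refine card_le_one.2 fun C hC C' hC' => ?_
    obtain ⟨hC, hCO⟩ := mem_filter.1 hC
    obtain ⟨hC', hC'O⟩ := mem_filter.1 hC'
    obtain ⟨z, -, rfl⟩ := mem_image.1 hC
    obtain ⟨z', -, rfl⟩ := mem_image.1 hC'
    obtain ⟨o, ho, hoC⟩ := not_disjoint_iff.1 hCO
    obtain ⟨o', ho', ho'C⟩ := not_disjoint_iff.1 hC'O
    have h1 := opart_subset_cls γ ⟨o, mem_inter.2 ⟨ho, hoC⟩⟩ ho'
    rw [← cls_eq_of_mem γ.1.rsharp_symm h1, cls_eq_of_mem γ.1.rsharp_symm ho'C]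
  · refine Nat.le_zero.2 (card_eq_zero.2 (filter_eq_empty_iff.2 fun C _ h => h ?_))
    rw [Contour.Opart, if_neg ht]
    exact disjoint_empty_left _

include hd in
/-- **The per-class inequality**: for every class `C` of the glued graph,
`(d+1)·2d + tC(C) ≤ (d+1)·clC(C) + (d+1)·2d·[C meets O_γ]`. A non-exterior class with an open edge at a
support site has two sites, so its filling has `≥ 2d + 2` boundary pairs, all of them closed half-edges of
the class; a non-exterior class without such an edge has an isolated support site with `2d` closed edges.
[cite: Grimmett2006, §7.5] -/
theorem per_class {C : Finset (Site d)} (hC : C ∈ γ.1.classes) :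
    (d + 1) * (2 * d) + γ.1.tC C ≤ (d + 1) * γ.1.clC C + (d + 1) * (2 * d) * (if Disjoint γ.1.Opart C then 0 else 1) := by
  classical
  obtain ⟨x₀, hx₀U, rfl⟩ := mem_image.1 hC
  have htc := tC_le_clC γ (cls γ.1.Rsharp γ.1.Ugl x₀)
  split_ifs with hO
  · rw [mul_zero, add_zero]
    have hx₀O : x₀ ∉ γ.1.Opart := fun h => Finset.disjoint_left.1 hO h (mem_cls_self hx₀U)
    obtain ⟨x, hxC, hxS, -⟩ := exists_mem_cls_supp hd γ hx₀U hx₀O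
    by_cases hopen : ∃ z ∈ cls γ.1.Rsharp γ.1.Ugl x₀ ∩ γ.1.supp, 0 < γ.1.oDeg z
    · -- an open edge at a support site: two sites in the class, `2d + 2` boundary pairs
      obtain ⟨z, hz, hzo⟩ := hopen
      obtain ⟨hzC, hzS⟩ := mem_inter.1 hz
      obtain ⟨y, hy⟩ := card_pos.1 (by rw [Contour.oDeg] at hzo; exact hzo)
      obtain ⟨hy, hyo⟩ := mem_filter.1 hy
      have hzy : (zdGraph d).Adj z y := mem_nbrs.1 hy
      have hyC : y ∈ cls γ.1.Rsharp γ.1.Ugl x₀ := by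
        by_contra hyC; exact not_isOpen_of_not_mem_cls hd γ hzS hzC hzy hyC hyo
      have h2 : 1 < #(γ.1.fill (cls γ.1.Rsharp γ.1.Ugl x₀)) :=
        lt_of_lt_of_le (one_lt_card.2 ⟨z, hzC, y, hyC, hzy.ne⟩) (card_le_card subset_union_left)
      have hbp := (le_card_boundaryPairs_of_one_lt hd h2).trans (card_boundaryPairs_fill_le hd γ hO)
      have h3 : d * (2 * d + 2) ≤ d * γ.1.clC (cls γ.1.Rsharp γ.1.Ugl x₀) := Nat.mul_le_mul_left d hbp
      linarith
    · -- no open edge at support sites of the class: `tC = 0`, and `x` has `2d` closed edges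
      push Not at hopen
      have ht0 : γ.1.tC (cls γ.1.Rsharp γ.1.Ugl x₀) = 0 := by
        rw [Contour.tC]
        exact sum_eq_zero fun z hz => by
          obtain ⟨hz, hzo⟩ := mem_filter.1 hz
          exact absurd (hopen z hz) (not_le.2 hzo)
      have hxo0 : γ.1.oDeg x = 0 := Nat.le_zero.1 (hopen x (mem_inter.2 ⟨hxC, hxS⟩))
      have hcx : γ.1.cDeg x = 2 * d := by have := oDeg_add_cDeg γ x; omega
      have hcl : 2 * d ≤ γ.1.clC (cls γ.1.Rsharp γ.1.Ugl x₀) := by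
        rw [← hcx, Contour.clC]
        exact single_le_sum (f := γ.1.cDeg) (fun _ _ => Nat.zero_le _) (mem_inter.2 ⟨hxC, hxS⟩)
      rw [ht0, add_zero]
      exact Nat.mul_le_mul_left (d + 1) hcl
  · have h1 : γ.1.clC (cls γ.1.Rsharp γ.1.Ugl x₀) ≤ (d + 1) * γ.1.clC (cls γ.1.Rsharp γ.1.Ugl x₀) :=
      Nat.le_mul_of_pos_left _ (Nat.succ_pos d)
    linarith

include hd in
/-- **Summed over classes**: `(d+1)·2d·ccl + Σ_C tC(C) ≤ (d+1)·Σ_C clC(C) + (d+1)·2d·[type = ord]`.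
[cite: Grimmett2006, §7.5] -/
theorem sum_per_class :
    (d + 1) * (2 * d) * γ.1.ccl + ∑ C ∈ γ.1.classes, γ.1.tC C ≤
      (d + 1) * ∑ C ∈ γ.1.classes, γ.1.clC C + (d + 1) * (2 * d) * (if γ.1.type = Phase.ord then 1 else 0) := by
  classical
  have h := sum_le_sum fun C hC => per_class hd γ hC
  have hL : ∑ C ∈ γ.1.classes, ((d + 1) * (2 * d) + γ.1.tC C) = (d + 1) * (2 * d) * γ.1.ccl + ∑ C ∈ γ.1.classes, γ.1.tC C := by
    rw [sum_add_distrib, sum_const, smul_eq_mul, card_classes]; ring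
  have hR : ∑ C ∈ γ.1.classes, ((d + 1) * γ.1.clC C + (d + 1) * (2 * d) * (if Disjoint γ.1.Opart C then 0 else 1)) =
      (d + 1) * ∑ C ∈ γ.1.classes, γ.1.clC C + (d + 1) * (2 * d) * ∑ C ∈ γ.1.classes, (if Disjoint γ.1.Opart C then 0 else 1) := by
    rw [sum_add_distrib, ← mul_sum, ← mul_sum]
  have hext : ∑ C ∈ γ.1.classes, (if Disjoint γ.1.Opart C then 0 else 1) ≤ if γ.1.type = Phase.ord then 1 else 0 := by
    have hb : ∀ C, (if Disjoint γ.1.Opart C then 0 else 1) = if ¬ Disjoint γ.1.Opart C then 1 else 0 := fun C => by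
      split_ifs <;> rfl
    simp_rw [hb]
    rw [sum_boole, Nat.cast_id]
    exact card_filter_ext_le γ
  rw [hL, hR] at h
  exact h.trans (Nat.add_le_add_left (Nat.mul_le_mul_left _ hext) _)

include hd in
/-- **The counting inequality of the Peierls estimate**, first form:
`Σ_C tC(C) + (d+1)·(e(γ) + 2d·cwt(γ)) ≤ (d+1)·2d·|γ̄|`. [cite: Grimmett2006, §7.5] -/
theorem sum_tC_add_le : ∑ C ∈ γ.1.classes, γ.1.tC C + (d + 1) * (γ.1.energy + 2 * d * γ.1.cwt) ≤ (d + 1) * (2 * d * #γ.1.supp) := by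
  have h1 := sum_per_class hd γ
  have h2 := sum_clC_add_energy γ
  have h3 : γ.1.ccl = γ.1.cwt + if γ.1.type = Phase.ord then 1 else 0 := by
    have := ccl_pos γ; rw [Contour.cwt]; split_ifs <;> omega
  rw [h3] at h1
  rw [← h2]
  nlinarith [h1]

/-! ### Bad sites are near mixed sites -/

/-- An intrinsically open ball edge gives a ball site with an open lattice edge. [folklore] -/
theorem exists_oDeg_pos_of_isOpen {b : Site d} {e : Sym2 (Site d)} (he : e ∈ ballEdges b) (ho : γ.1.IsOpen e) :
    ∃ u ∈ starBall b, 0 < γ.1.oDeg u := by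
  induction e using Sym2.ind with
  | h u v =>
    obtain ⟨huv, hb⟩ := mem_ballEdges_iff.1 he
    rw [SimpleGraph.mem_edgeSet] at huv
    rw [coBall_mk, mem_inter] at hb
    exact ⟨u, mem_starBall_comm.1 hb.1, oDeg_pos_of_isOpen γ huv ho⟩

/-- An intrinsically closed ball edge gives a ball site with a closed lattice edge. [folklore] -/
theorem exists_oDeg_lt_of_not_isOpen {b : Site d} {e : Sym2 (Site d)} (he : e ∈ ballEdges b) (ho : ¬ γ.1.IsOpen e) :
    ∃ u ∈ starBall b, γ.1.oDeg u < 2 * d := by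
  induction e using Sym2.ind with
  | h u v =>
    obtain ⟨huv, hb⟩ := mem_ballEdges_iff.1 he
    rw [SimpleGraph.mem_edgeSet] at huv
    rw [coBall_mk, mem_inter] at hb
    exact ⟨u, mem_starBall_comm.1 hb.1, oDeg_lt_of_not_isOpen γ huv ho⟩

/-- **A bad site sees a mixed site**: the ball of an intrinsically bad site contains a site with an open
and a closed lattice edge (walk inside the ball from an open edge to a closed one). [cite: FriedliVelenik2017, §7.2.1] -/
theorem exists_mixed_of_iBad {b : Site d} (hb : γ.1.IBad b) :
    ∃ w ∈ starBall b, 0 < γ.1.oDeg w ∧ γ.1.oDeg w < 2 * d := by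
  classical
  obtain ⟨hno, hnd⟩ := hb
  obtain ⟨e₂, he₂, ho₂⟩ : ∃ e ∈ ballEdges b, γ.1.IsOpen e := by
    by_contra h; push Not at h; exact hnd h
  obtain ⟨e₁, he₁, ho₁⟩ : ∃ e ∈ ballEdges b, ¬ γ.1.IsOpen e := by
    by_contra h; push Not at h; exact hno h
  obtain ⟨u, hu, huo⟩ := exists_oDeg_pos_of_isOpen γ he₂ ho₂
  obtain ⟨u', hu', hu'o⟩ := exists_oDeg_lt_of_not_isOpen γ he₁ ho₁
  by_cases hlt : γ.1.oDeg u < 2 * d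
  · exact ⟨u, hu, huo, hlt⟩
  have hu2 : γ.1.oDeg u = 2 * d := le_antisymm (Contour.oDeg_le_two_mul γ u) (not_lt.1 hlt)
  obtain ⟨w, w', hw, hw', hadj, hbw, hbw'⟩ := exists_adj_flip (P := fun w => γ.1.oDeg w = 2 * d) hu2 hu'o.ne
  have ho : γ.1.IsOpen s(w', w) := by rw [Sym2.eq_swap]; exact isOpen_of_oDeg_eq γ hw hadj
  exact ⟨w', mem_starBall_of_between hu hu' hbw', oDeg_pos_of_isOpen γ hadj.symm ho,
    lt_of_le_of_ne (Contour.oDeg_le_two_mul γ w') hw'⟩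

/-- The mixed sites of the support: an open and a closed lattice edge. [folklore] -/
def Contour.mixed (γ : Contour d) : Finset (Site d) := γ.supp.filter fun x => 0 < γ.oDeg x ∧ γ.oDeg x < 2 * d

include hd in
/-- **`|γ̄| ≤ 9^d · #mixed`**: the support is the thickening of its bad sites (`|γ̄| ≤ 3^d #bad`), and every
bad site has a mixed site in its ball (`#bad ≤ 3^d #mixed`). [cite: FriedliVelenik2017, §7.2.6, Def. 7.18] -/
theorem card_supp_le_mixed : #γ.1.supp ≤ 9 ^ d * #γ.1.mixed := by
  classical
  obtain ⟨h1, -, -, -, -, -⟩ := WF.consistency hd γ.2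
  set B := γ.1.supp.filter fun b => γ.1.IBad b with hB
  have hSB : #γ.1.supp ≤ 3 ^ d * #B := by
    calc #γ.1.supp ≤ #(B.biUnion starBall) := card_le_card fun y hy => by
            obtain ⟨b, hb, hbad, hyb⟩ := (h1 y).1 hy
            exact mem_biUnion.2 ⟨b, mem_filter.2 ⟨hb, hbad⟩, hyb⟩
      _ ≤ ∑ b ∈ B, #(starBall b) := card_biUnion_le
      _ = 3 ^ d * #B := by rw [sum_congr rfl fun b _ => card_starBall b, sum_const, smul_eq_mul, mul_comm]
  have hBM : #B ≤ 3 ^ d * #γ.1.mixed := by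
    calc #B ≤ #(γ.1.mixed.biUnion starBall) := card_le_card fun b hb => by
            obtain ⟨hbS, hbad⟩ := mem_filter.1 hb
            obtain ⟨w, hw, hwo, hwc⟩ := exists_mixed_of_iBad γ hbad
            have hwS : w ∈ γ.1.supp := (h1 w).2 ⟨b, hbS, hbad, hw⟩
            exact mem_biUnion.2 ⟨w, mem_filter.2 ⟨hwS, hwo, hwc⟩, mem_starBall_comm.1 hw⟩
      _ ≤ ∑ w ∈ γ.1.mixed, #(starBall w) := card_biUnion_le
      _ = 3 ^ d * #γ.1.mixed := by rw [sum_congr rfl fun b _ => card_starBall b, sum_const, smul_eq_mul, mul_comm]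
  calc #γ.1.supp ≤ 3 ^ d * #B := hSB
    _ ≤ 3 ^ d * (3 ^ d * #γ.1.mixed) := Nat.mul_le_mul_left _ hBM
    _ = 9 ^ d * #γ.1.mixed := by rw [← mul_assoc, ← mul_pow]; norm_num

/-- `#mixed ≤ Σ_C tC(C)`: every mixed site carries a closed edge and an open one. [folklore] -/
theorem card_mixed_le_sum_tC : #γ.1.mixed ≤ ∑ C ∈ γ.1.classes, γ.1.tC C := by
  rw [sum_tC_eq, Contour.mixed, card_eq_sum_ones]
  calc ∑ x ∈ γ.1.supp.filter (fun x => 0 < γ.1.oDeg x ∧ γ.1.oDeg x < 2 * d), 1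
      ≤ ∑ x ∈ γ.1.supp.filter (fun x => 0 < γ.1.oDeg x ∧ γ.1.oDeg x < 2 * d), γ.1.cDeg x :=
        sum_le_sum fun x hx => by
          obtain ⟨-, -, hlt⟩ := mem_filter.1 hx
          have := oDeg_add_cDeg γ x; omega
    _ ≤ _ := sum_le_sum_of_subset_of_nonneg (fun x hx => by
          obtain ⟨hxS, ho, -⟩ := mem_filter.1 hx
          exact mem_filter.2 ⟨hxS, ho⟩) fun _ _ _ => Nat.zero_le _

include hd in
/-- **The Peierls counting inequality for random-cluster contours.** For every well-formed contour `γ`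
of the random-cluster model on `ℤ^d`, `d ≥ 2`,
`|γ̄| + 9^d (d+1) (e(γ) + 2d·cwt(γ)) ≤ 9^d (d+1) · 2d · |γ̄|`,
i.e. `e(γ)/(2d) + cwt(γ) ≤ |γ̄| (1 - 1/(2d(d+1)9^d))`: measured in units of `log q` at the balance point
`t^{2d} = q` of the two ground weights (`w_ord = t^{2d}` per site, `w_dis = q` per site), the weight
`t^{e(γ)} q^{cwt(γ)}` of a contour falls short of the ground weight of its support by a fixed fraction of
`|γ̄|`. This is the energy–entropy input ("Peierls condition") of the Pirogov–Sinai analysis of the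
large-`q` random-cluster model (Laanait–Messager–Miracle-Solé–Ruiz–Shlosman 1991; Grimmett 2006, §7.5,
where the corresponding estimate enters through Thm. (7.42) with `τ = (1/8d) log q - 5`), here for the thick
site-contours of Friedli–Velenik Ch. 7. [cite: Grimmett2006, §7.5, Thm. (7.42) and eq. (7.44); FriedliVelenik2017, §7.2 (Peierls condition)] -/
theorem peierls_counting :
    #γ.1.supp + 9 ^ d * (d + 1) * (γ.1.energy + 2 * d * γ.1.cwt) ≤ 9 ^ d * (d + 1) * (2 * d * #γ.1.supp) := by
  have h1 := sum_tC_add_le hd γ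
  have h2 := card_supp_le_mixed hd γ
  have h3 := card_mixed_le_sum_tC γ
  have h4 : #γ.1.supp ≤ 9 ^ d * ∑ C ∈ γ.1.classes, γ.1.tC C := h2.trans (Nat.mul_le_mul_left _ h3)
  have h5 := Nat.mul_le_mul_left (9 ^ d) h1
  rw [mul_add] at h5
  calc #γ.1.supp + 9 ^ d * (d + 1) * (γ.1.energy + 2 * d * γ.1.cwt)
      ≤ 9 ^ d * ∑ C ∈ γ.1.classes, γ.1.tC C + 9 ^ d * ((d + 1) * (γ.1.energy + 2 * d * γ.1.cwt)) := by
        rw [mul_assoc]; exact Nat.add_le_add_right h4 _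
    _ ≤ 9 ^ d * ((d + 1) * (2 * d * #γ.1.supp)) := h5
    _ = 9 ^ d * (d + 1) * (2 * d * #γ.1.supp) := by ring

include hd in
/-- The weight exponent never exceeds the ground exponent: `e(γ) + 2d·cwt(γ) ≤ 2d |γ̄|`. [cite: Grimmett2006, §7.5] -/
theorem energy_add_le : γ.1.energy + 2 * d * γ.1.cwt ≤ 2 * d * #γ.1.supp := by
  have h := peierls_counting hd γ
  have h9 : 0 < 9 ^ d * (d + 1) := by positivity
  nlinarith

end Peierls

/-! ### 4. The Peierls estimate for the contour weights -/

section Weights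

variable (hd : 2 ≤ d) (γ : (rcSetup d).Γ)

/-- **The Peierls rate of the large-`q` random-cluster model** obtained here:
`τ(q) = log q / (2d(d+1)9^d) - 2` (Grimmett 2006, (7.44), has `(1/8d) log q - 5` for his contours).
[cite: Grimmett2006, §7.5, eq. (7.44)] -/
def rcPeierlsRate (d : ℕ) (q : ℝ) : ℝ := Real.log q / (2 * d * (d + 1) * 9 ^ d) - 2

include hd in
/-- **The Peierls estimate (weight form).** For a well-formed contour `γ`, `t > 0`, `q ≥ 1` in the window
`|2d log t - log q| ≤ 1` around the balance point of the two ground weights (`t^{2d}` per site for `ord`,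
`q` per site for `dis`; here `t² = p/(1-p)`):
`t^{e(γ)} q^{cwt(γ)} ≤ e^{-τ(q)|γ̄|} · min(t^{2d}, q)^{|γ̄|}` with `τ(q) = rcPeierlsRate d q`. In particular
the contour weight normalised by the ground weight of its type is at most `e^{-τ(q)|γ̄|}`, the `τ`-stability
("Peierls condition") required by the Pirogov–Sinai analysis (`ContourModel`, hypothesis `hρτ` of
`ContourModel.K_le_exp_of_excess_eq_zero`). [cite: Grimmett2006, §7.5, Thm. (7.42) with (7.44) and (7.55); FriedliVelenik2017, §7.4.2, eq. (7.52)] -/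
theorem peierls_weight {t q : ℝ} (ht : 0 < t) (hq : 1 ≤ q) (hwin : |2 * d * Real.log t - Real.log q| ≤ 1) :
    t ^ γ.1.energy * q ^ γ.1.cwt ≤
      Real.exp (-rcPeierlsRate d q * (rcSetup d).size γ) * min (t ^ (2 * d)) q ^ (rcSetup d).size γ := by
  have hq0 : 0 < q := one_pos.trans_le hq
  set L := Real.log q with hL
  set ℓ := Real.log t with hℓ
  set n : ℕ := (rcSetup d).size γ with hn
  have hnS : #γ.1.supp = n := rfl
  set e := γ.1.energy with he
  set c := γ.1.cwt with hc
  have hL0 : 0 ≤ L := Real.log_nonneg hq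
  have hd0 : (0 : ℝ) < d := by exact_mod_cast (show 0 < d by omega)
  set A : ℝ := 9 ^ d * (d + 1) with hA
  have hA0 : 0 < A := by positivity
  -- the counting inequality, in `ℝ`
  have hcomb : (n : ℝ) + A * (e + 2 * d * c) ≤ A * (2 * d * n) := by
    have := peierls_counting hd γ
    rw [hnS] at this
    have h' : ((n + 9 ^ d * (d + 1) * (e + 2 * d * c) : ℕ) : ℝ) ≤ ((9 ^ d * (d + 1) * (2 * d * n) : ℕ) : ℝ) := by
      exact_mod_cast this
    push_cast at h'
    rw [hA]; linarith
  have hen : (e : ℝ) ≤ 2 * d * n := by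
    have := energy_add_le hd γ
    rw [hnS] at this
    have h' : ((e + 2 * d * c : ℕ) : ℝ) ≤ ((2 * d * n : ℕ) : ℝ) := by exact_mod_cast this
    push_cast at h'
    have : (0 : ℝ) ≤ 2 * d * c := by positivity
    linarith
  have hwin' : 2 * d * ℓ ≤ L + 1 := by have := (abs_le.1 hwin).2; linarith
  have hwin'' : L - 1 ≤ 2 * d * ℓ := by have := (abs_le.1 hwin).1; linarith
  -- the exponent inequality
  have key : e * ℓ + c * L ≤ -rcPeierlsRate d q * n + n * (L - 1) := by
    have p1 : (e : ℝ) * (2 * d * ℓ) ≤ e * (L + 1) := mul_le_mul_of_nonneg_left hwin' (Nat.cast_nonneg _)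
    have p1' := mul_le_mul_of_nonneg_left p1 hA0.le
    have p2 := mul_le_mul_of_nonneg_left hcomb hL0
    have p3 := mul_le_mul_of_nonneg_left hen hA0.le
    have hgoal : 2 * d * A * (e * ℓ + c * L) ≤ 2 * d * A * (L * n + n) - L * n := by linarith
    have h2dA : (0 : ℝ) < 2 * d * A := by positivity
    rw [rcPeierlsRate, ← hL]
    have : -(L / (2 * d * (d + 1) * 9 ^ d) - 2) * n + n * (L - 1) = ((2 * d * A * (L * n + n) - L * n)) / (2 * d * A) := by
      rw [hA]; field_simp; ring
    rw [this, le_div_iff₀ h2dA]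
    linarith
  -- assemble
  have hlhs : t ^ e * q ^ c = Real.exp (e * ℓ + c * L) := by
    rw [Real.exp_add, hℓ, hL, Real.exp_nat_mul, Real.exp_nat_mul, Real.exp_log ht, Real.exp_log hq0]
  have hmin : Real.exp (L - 1) ≤ min (t ^ (2 * d)) q := by
    refine le_min ?_ ?_
    · have ht2 : t ^ (2 * d) = Real.exp ((2 * d : ℕ) * ℓ) := by rw [Real.exp_nat_mul, hℓ, Real.exp_log ht]
      rw [ht2, Real.exp_le_exp]; push_cast; linarith
    · calc Real.exp (L - 1) ≤ Real.exp L := Real.exp_le_exp.2 (by linarith)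
        _ = q := by rw [hL, Real.exp_log hq0]
  calc t ^ e * q ^ c = Real.exp (e * ℓ + c * L) := hlhs
    _ ≤ Real.exp (-rcPeierlsRate d q * n + n * (L - 1)) := Real.exp_le_exp.2 key
    _ = Real.exp (-rcPeierlsRate d q * n) * Real.exp (L - 1) ^ n := by rw [Real.exp_add, Real.exp_nat_mul]
    _ ≤ Real.exp (-rcPeierlsRate d q * n) * min (t ^ (2 * d)) q ^ n :=
        mul_le_mul_of_nonneg_left (pow_le_pow_left₀ (Real.exp_nonneg _) hmin n) (Real.exp_nonneg _)

include hd in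
/-- **Peierls estimate relative to the `ord` ground weight** `t^{2d}` per site: in the window,
`t^{e(γ)} q^{cwt(γ)} ≤ e^{-τ(q)|γ̄|} (t^{2d})^{|γ̄|}`. [cite: Grimmett2006, §7.5, Thm. (7.42), eq. (7.55) (wired contours)] -/
theorem peierls_weight_ord {t q : ℝ} (ht : 0 < t) (hq : 1 ≤ q) (hwin : |2 * d * Real.log t - Real.log q| ≤ 1) :
    t ^ γ.1.energy * q ^ γ.1.cwt ≤ Real.exp (-rcPeierlsRate d q * (rcSetup d).size γ) * (t ^ (2 * d)) ^ (rcSetup d).size γ :=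
  (peierls_weight hd γ ht hq hwin).trans (mul_le_mul_of_nonneg_left
    (pow_le_pow_left₀ (le_min (pow_nonneg ht.le _) (zero_le_one.trans hq)) (min_le_left _ _) _) (Real.exp_nonneg _))

include hd in
/-- **Peierls estimate relative to the `dis` ground weight** `q` per site: in the window,
`t^{e(γ)} q^{cwt(γ)} ≤ e^{-τ(q)|γ̄|} q^{|γ̄|}`. [cite: Grimmett2006, §7.5, Thm. (7.42), eq. (7.55) (free contours)] -/
theorem peierls_weight_dis {t q : ℝ} (ht : 0 < t) (hq : 1 ≤ q) (hwin : |2 * d * Real.log t - Real.log q| ≤ 1) :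
    t ^ γ.1.energy * q ^ γ.1.cwt ≤ Real.exp (-rcPeierlsRate d q * (rcSetup d).size γ) * q ^ (rcSetup d).size γ :=
  (peierls_weight hd γ ht hq hwin).trans (mul_le_mul_of_nonneg_left
    (pow_le_pow_left₀ (le_min (pow_nonneg ht.le _) (zero_le_one.trans hq)) (min_le_right _ _) _) (Real.exp_nonneg _))

/-- The Peierls rate is large for large `q`: `τ(q) ≥ τ₀` as soon as `log q ≥ 2d(d+1)9^d (τ₀ + 2)`.
[cite: Grimmett2006, §7.5, eq. (7.44)] -/
theorem le_rcPeierlsRate (hd1 : 1 ≤ d) {q τ₀ : ℝ} (h : 2 * d * (d + 1) * 9 ^ d * (τ₀ + 2) ≤ Real.log q) : τ₀ ≤ rcPeierlsRate d q := by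
  have hd0 : (0 : ℝ) < d := by exact_mod_cast hd1
  have hpos : (0 : ℝ) < 2 * d * (d + 1) * 9 ^ d := by positivity
  rw [rcPeierlsRate, le_sub_iff_add_le, le_div_iff₀ hpos]
  linarith

end Weights

end RCC


end Literature.Probability.LatticeModels
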